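import Summits.QuantumFields.YangMills.Theses.AdjointLoopFano
import Summits.QuantumFields.YangMills.Theorems.FemtoTransferGapZeroModes
import Summits.QuantumFields.YangMills.Theorems.FemtoTransferGapBounds
import HarnessLib

/-!
# `AdjointLoopFano.Assembly` (item stmt-QuantumFields-23324) — PROVED:
# `VacuumHolonomyFano → AdjointLoopDirichlet → FirstLevelPolyTail → ThermalTraceWindow.SubFemtoFirstLevel`

Route `AdjointLoopFano` (D-0145 LINE g16-B of seat ym-idea-4, rev 1; draft-by-design onto the leaf K2a =
`ThermalTraceWindow.SubFemtoFirstLevel`, item stmt-QuantumFields-28291).  This file proves the route's Assembly, exactly along the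
planner's two-case split:

* window `L ≤ β^{1/2}`: in the exact `l2`-normalised vacuum `Ω` (tree `PhysL2.exists_groundState`) take the multiplier
  `F = flowLift 0 d`, `d(u) = 4 − (Re tr u(e₀))²` (§1: `d` is a physical one-site function, hence `F` is physical by the tree's
  `isPhys_flowLift`); the LANDED single-mode door `Deficit.pow_secondValue_ge_deficit` at `m = 1` gives `λ₀·Var − D₁ ≤ λ₁·Var`;
  `AdjointLoopDirichlet` at `ε = 1/12` gives `D₁ ≤ C β^{−11/12} λ₀ m₁ / L` and `VacuumHolonomyFano` at `(a, q, M) = (1/2, 11/12, 4C)`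
  gives `4C β^{−11/12} m₁ ≤ Var`, `Var > 0`; hence `D₁ ≤ λ₀ Var/(4L)`, `λ₁ ≥ λ₀ (1 − 1/(4L))`, and Bernoulli
  `(1 − 1/(4L))^L ≥ 3/4 ≥ β^{−1}` (`β ≥ 2`) gives `β^{−1} λ₀^L ≤ λ₁^L`;
* tail `β^{1/2} ≤ L ≤ β^A`: `FirstLevelPolyTail` at `a = 1/2` verbatim;

with the uniform exponent `k = max k₃ 1` (`β^{−k}` is antitone in `k` for `β ≥ 1`) and `levelValue_zero/one`.

HONEST FRAMING: bookkeeping (real arithmetic + one call of the landed door); the cruxes `VacuumHolonomyFano`, `AdjointLoopDirichlet`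
and the residual `FirstLevelPolyTail` are OPEN; K2a, R2ξ″ and every summit statement remain OPEN; the YM mass gap is NOT proved.
No `sorry`, no new axiom, no new definition.
References: [cite: ReedSimonIV1978, Thm. XIII.1]; [cite: Luscher1983, §2–3].
-/

set_option autoImplicit false

noncomputable section

open MeasureTheory Filter Topology Real
open scoped Matrix ComplexConjugate BigOperators
open Literature.MathematicalPhysics.QuantumFieldTheory hiding SU2
open Literature.MathematicalPhysics.QuantumLattice

namespace Summit.QuantumFields.YangMills.Theorems.AdjointLoopFano

open Summit.QuantumFields.YangMills.Theorems.FemtoTransferGap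

/-! ## §1 The adjoint Polyakov deviation is a physical one-site function -/

/-- **The adjoint Polyakov deviation `d(u) = 4 − (Re tr u(e₀))²` is a physical one-site function**: continuous, `0 ≤ d ≤ 4`
(`|Re tr W| ≤ 2` on `SU(2)`), invariant under simultaneous conjugation (cyclicity of the trace) and under the centre `±1`
(the square kills the sign). [cite: Luscher1983, §2] -/
theorem isPhys_adjDev :
    IsPhys (fun u : GaugeConfig 3 1 SU2 =>
      4 - ((su2Rep (u ((0 : Site 3 1), (0 : Fin 3)))).trace.re) ^ 2) := by
  refine isPhys_of_invariant ?_ ⟨4, fun U => ?_⟩ (fun V U => ?_) (fun k U => ?_)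
  · have h1 : Continuous fun u : GaugeConfig 3 1 SU2 => su2Rep (u ((0 : Site 3 1), (0 : Fin 3))) :=
      continuous_su2Rep.comp (continuous_apply _)
    exact continuous_const.sub ((Complex.continuous_re.comp h1.matrix_trace).pow 2)
  · have h1 := re_trace_le_two (U ((0 : Site 3 1), (0 : Fin 3)))
    have h2 := neg_two_le_re_trace (U ((0 : Site 3 1), (0 : Fin 3)))
    rw [fundamentalRep_apply, abs_le]
    constructor <;> nlinarith
  · simp only [map_mul]
    rw [Matrix.trace_mul_cycle, ← map_mul, inv_mul_cancel, map_one, one_mul]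
  · dsimp only
    split_ifs with h
    · simp [fundamentalRep_apply]
    · rfl

/-! ## §2 Elementary real-analysis steps -/

/-- Bernoulli: `3/4 ≤ (1 − 1/(4L))^L` for `L ≥ 1`. [folklore] -/
theorem three_quarters_le_pow (L : ℕ) (hL : 1 ≤ L) : (3 : ℝ) / 4 ≤ (1 - 1 / (4 * (L : ℝ))) ^ L := by
  have hL' : (1 : ℝ) ≤ L := by exact_mod_cast hL
  have h : (-2 : ℝ) ≤ -(1 / (4 * (L : ℝ))) := by
    have : 1 / (4 * (L : ℝ)) ≤ 1 / 4 := by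
      apply div_le_div_of_nonneg_left (by norm_num) (by norm_num)
      linarith
    linarith
  have hb := one_add_mul_le_pow h L
  have hL0 : (0 : ℝ) < L := by linarith
  have : 1 + (L : ℝ) * -(1 / (4 * (L : ℝ))) = 3 / 4 := by
    field_simp; ring
  rw [this] at hb
  simpa [sub_eq_add_neg] using hb

/-- `β^{−k} ≤ β^{−k'}` for `1 ≤ β` and `k' ≤ k`. [folklore] -/
theorem rpow_neg_antitone {β k k' : ℝ} (hβ : 1 ≤ β) (hk : k' ≤ k) : β ^ (-k) ≤ β ^ (-k') :=
  Real.rpow_le_rpow_of_exponent_le hβ (neg_le_neg hk)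

/-! ## §3 The Assembly -/

/-- **Assembly of route `AdjointLoopFano`** (item stmt-QuantumFields-23324):
`VacuumHolonomyFano → AdjointLoopDirichlet → FirstLevelPolyTail → ThermalTraceWindow.SubFemtoFirstLevel`.
Case `L ≤ β^{1/2}`: single-mode door (`Deficit.pow_secondValue_ge_deficit`, `m = 1`) for `F = flowLift 0 d` in the exact vacuum,
`D₁ ≤ λ₀ Var/(4L)` from the two cruxes at `(ε, a, q, M) = (1/12, 1/2, 11/12, 4C)`, Bernoulli; case `β^{1/2} ≤ L ≤ β^A`: the residual
tail item. [cite: ReedSimonIV1978, Thm. XIII.1] [cite: Luscher1983, §3] -/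
theorem assembly_proof : Summit.QuantumFields.YangMills.Theses.AdjointLoopFano.Assembly := by
  intro h1 h2 h3 A hA
  -- constants from the three items
  obtain ⟨C, β₂, hC⟩ := h2 (1 / 12) (by norm_num)
  obtain ⟨β₁, L₁, hV⟩ := h1 (1 / 2) (11 / 12) (4 * C) (by norm_num) (by norm_num) (by norm_num) (by norm_num)
  obtain ⟨k₃, β₃, L₃, hT⟩ := h3 (1 / 2) (by norm_num) A hA
  refine ⟨max k₃ 1, max (max β₁ β₂) (max β₃ 2), max L₁ L₃, ?_⟩
  intro β hβ L _ hL hLA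
  have hβ₁ : β₁ ≤ β := le_trans (le_trans (le_max_left _ _) (le_max_left _ _)) hβ
  have hβ₂ : β₂ ≤ β := le_trans (le_trans (le_max_right _ _) (le_max_left _ _)) hβ
  have hβ₃ : β₃ ≤ β := le_trans (le_trans (le_max_left _ _) (le_max_right _ _)) hβ
  have hβ2 : (2 : ℝ) ≤ β := le_trans (le_trans (le_max_right _ _) (le_max_right _ _)) hβ
  have hβ1 : (1 : ℝ) ≤ β := by linarith
  have hβpos : 0 < β := by linarith
  have hL₁ : L₁ ≤ L := le_trans (le_max_left _ _) hL
  have hL₃ : L₃ ≤ L := le_trans (le_max_right _ _) hL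
  have hLone : 1 ≤ L := NeZero.one_le
  -- `β^{−k}` bookkeeping
  have hk1 : β ^ (-(max k₃ 1)) ≤ β ^ (-(1 : ℝ)) := rpow_neg_antitone hβ1 (le_max_right _ _)
  have hk3 : β ^ (-(max k₃ 1)) ≤ β ^ (-k₃) := rpow_neg_antitone hβ1 (le_max_left _ _)
  have hT0 : 0 < topValue su2Rep L β := topValue_su2Rep_pos L β
  have hpow0 : 0 ≤ levelValue su2Rep L β 0 ^ L := by
    rw [levelValue_zero]; exact pow_nonneg hT0.le L
  by_cases hcase : (L : ℝ) ≤ β ^ (1 / 2 : ℝ)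
  · -- ### the window `L ≤ β^{1/2}`: single-mode door in the exact vacuum
    obtain ⟨Ω, θ, c, hΩ, -, -, hn, heig, -, -, -⟩ := PhysL2.exists_groundState (L := L) β
    set d : GaugeConfig 3 1 SU2 → ℝ := fun u => 4 - ((su2Rep (u ((0 : Site 3 1), (0 : Fin 3)))).trace.re) ^ 2 with hd_def
    have hd : IsPhys d := isPhys_adjDev
    set F : GaugeConfig 3 L SU2 → ℝ := flowLift 0 d with hF_def
    have hF : IsPhys F := isPhys_flowLift 0 hd
    obtain ⟨CF, hCF⟩ := hF.bounded
    set φ : GaugeConfig 3 L SU2 → ℝ := fun U => F U * Ω U with hφ_def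
    -- the door (m = 1)
    have hdoor := Deficit.pow_secondValue_ge_deficit hβpos hF.measurable hCF hF.gaugeInv hF.zeroFlux hΩ hn heig
      (m := 1) le_rfl
    simp only [pow_one, Function.iterate_one] at hdoor
    -- the two cruxes
    have hD : topValue su2Rep L β * l2 φ φ - l2 φ (transferApply β φ) ≤
        C * β ^ ((1 : ℝ) / 12 - 1) / L * topValue su2Rep L β * l2 φ Ω := hC β hβ₂ L Ω hΩ hn heig
    have hVar : 4 * C * β ^ (-(11 / 12 : ℝ)) * l2 φ Ω ≤ l2 φ φ - l2 φ Ω ^ 2 ∧ 0 < l2 φ φ - l2 φ Ω ^ 2 :=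
      hV β hβ₁ L hL₁ hcase Ω hΩ hn heig
    obtain ⟨hV1, hV2⟩ := hVar
    have hexp : β ^ ((1 : ℝ) / 12 - 1) = β ^ (-(11 / 12 : ℝ)) := by norm_num
    rw [hexp] at hD
    -- abbreviations
    set T := topValue su2Rep L β with hT_def
    set S := secondValue su2Rep L β with hS_def
    set V := l2 φ φ - l2 φ Ω ^ 2 with hV_def
    set m₁ := l2 φ Ω with hm₁_def
    set D := T * l2 φ φ - l2 φ (transferApply β φ) with hD_def
    have hLpos : (0 : ℝ) < L := by exact_mod_cast (lt_of_lt_of_le zero_lt_one hLone)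
    -- `D ≤ T V/(4L)`
    have hD' : D ≤ T * V / (4 * L) := by
      have h1 : C * β ^ (-(11 / 12 : ℝ)) * m₁ ≤ V / 4 := by linarith
      have h2 : C * β ^ (-(11 / 12 : ℝ)) / L * T * m₁ = (T / L) * (C * β ^ (-(11 / 12 : ℝ)) * m₁) := by
        field_simp
      calc D ≤ C * β ^ (-(11 / 12 : ℝ)) / L * T * m₁ := hD
        _ = (T / L) * (C * β ^ (-(11 / 12 : ℝ)) * m₁) := h2
        _ ≤ (T / L) * (V / 4) := mul_le_mul_of_nonneg_left h1 (div_nonneg hT0.le hLpos.le)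
        _ = T * V / (4 * L) := by field_simp
    -- `T (1 − 1/(4L)) ≤ S`
    have hS : T * (1 - 1 / (4 * (L : ℝ))) ≤ S := by
      have h1 : T * V - T * V / (4 * L) ≤ S * V := by linarith
      have h2 : T * (1 - 1 / (4 * (L : ℝ))) * V ≤ S * V := by
        have : T * (1 - 1 / (4 * (L : ℝ))) * V = T * V - T * V / (4 * L) := by field_simp
        rw [this]; exact h1
      exact le_of_mul_le_mul_right h2 hV2
    have hq0 : 0 ≤ 1 - 1 / (4 * (L : ℝ)) := by
      have : 1 / (4 * (L : ℝ)) ≤ 1 / 4 := by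
        apply div_le_div_of_nonneg_left (by norm_num) (by norm_num)
        have : (1 : ℝ) ≤ L := by exact_mod_cast hLone
        linarith
      linarith
    have hTS0 : 0 ≤ T * (1 - 1 / (4 * (L : ℝ))) := mul_nonneg hT0.le hq0
    -- powers
    have hSL : (T * (1 - 1 / (4 * (L : ℝ)))) ^ L ≤ S ^ L := pow_le_pow_left₀ hTS0 hS L
    have hB : (3 : ℝ) / 4 * T ^ L ≤ (T * (1 - 1 / (4 * (L : ℝ)))) ^ L := by
      rw [mul_pow, mul_comm]
      exact mul_le_mul_of_nonneg_left (three_quarters_le_pow L hLone) (pow_nonneg hT0.le L)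
    have hβinv : β ^ (-(1 : ℝ)) ≤ 3 / 4 := by
      rw [Real.rpow_neg_one]
      rw [inv_le_comm₀ hβpos (by norm_num)]
      linarith
    rw [levelValue_zero, levelValue_one]
    calc β ^ (-(max k₃ 1)) * T ^ L ≤ β ^ (-(1 : ℝ)) * T ^ L :=
          mul_le_mul_of_nonneg_right hk1 (pow_nonneg hT0.le L)
      _ ≤ 3 / 4 * T ^ L := mul_le_mul_of_nonneg_right hβinv (pow_nonneg hT0.le L)
      _ ≤ (T * (1 - 1 / (4 * (L : ℝ)))) ^ L := hB
      _ ≤ S ^ L := hSL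
  · -- ### the tail `β^{1/2} ≤ L ≤ β^A`: the residual item verbatim
    have hge : β ^ (1 / 2 : ℝ) ≤ (L : ℝ) := (not_le.mp hcase).le
    have h := hT β hβ₃ L hL₃ hge hLA
    calc β ^ (-(max k₃ 1)) * levelValue su2Rep L β 0 ^ L ≤ β ^ (-k₃) * levelValue su2Rep L β 0 ^ L :=
          mul_le_mul_of_nonneg_right hk3 hpow0
      _ ≤ levelValue su2Rep L β 1 ^ L := h

end Summit.QuantumFields.YangMills.Theorems.AdjointLoopFano

end
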